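import Summits.Parity.GeneralizedHardyLittlewood.Theorems.PrimeLevelFamEdgeMomentsBeyondDiagonalDiagBoseMixedStructure
import HarnessLib

/-!
# Route `PrimeLevelFamEdge`, crux K_A `MomentsBeyondDiagonal` (stmt-Parity-20007), line «petersson_layers» v4, stub `stub_diag`:
# **census R2 — the Bose remainder in the `√y`-form consumed by the two-variable Abel estimate**

`…DiagCornerAbelBVTwoVar.abs_doubleSum_bv_pow_le` (p820228) and `…DiagCornerAbelBV.sum_abs_sub_le_of_lipschitz_sqrt`
(p820176) want, on `(0,1]`, a weight with `|r(y)| ≤ C√y` and `|r(y₁) − r(y₂)| ≤ C(y₂−y₁)/√y₁`. The Bose remainder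
`R_ab(y) = ∫₀^y ρ_ab(η)dη/η` of `…DiagBoseMixedStructure.bose_coeff_structure` satisfies `|R_ab(y)| ≤ Cy(1+L)^{N}` and
`|R_ab(y₂) − R_ab(y₁)| ≤ C₁(y₂−y₁)(1+L_{y₁})^{N}` (`N = a+b+1`, `…DiagBoseMixedRemainder`); since `√y(1+log(1/y))^N` is bounded
on `(0,1]`:

* `sqrt_mul_one_add_log_pow_le` — `√y·(1+log(1/y))^N ≤ 2^N(1+(2N)^N)` for `0 < y ≤ 1`;
* `abs_shell_rem_le_sqrt` — **`|R_ab(y)| ≤ C√y`** (`0<y≤1`);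
* `abs_shell_rem_sub_le_sqrt` — **`|R_ab(y₁) − R_ab(y₂)| ≤ C(y₂−y₁)/√y₁`** (`0<y₁≤y₂≤1`).

Def-free; theorems only. Helper `--supports stmt-Parity-20007`; closes nothing; K_A, K_B and the Parity summit are NOT
proved; nothing about Landau–Siegel zeros.

## References
* E. Kowalski, P. Michel, J. VanderKam, J. reine angew. Math. 526 (2000), (22)–(28) pp. 12–15 and Prop. 5.1 p. 18.
  [cite: KowalskiMichelVanderKam2000, (22)–(28) — derivation (remainder of the diagonal weight, real-variable form)]
-/

noncomputable section

open Real Set MeasureTheory Filter Function Finset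

namespace Summit.Parity.GeneralizedHardyLittlewood.Theorems.MomentsBeyondDiagonal.DiagLines

/-- `√y·(1+log(1/y))^N ≤ 2^N(1+(2N)^N)` for `0 < y ≤ 1`. [folklore] -/
theorem sqrt_mul_one_add_log_pow_le (N : ℕ) {y : ℝ} (hy0 : 0 < y) (hy1 : y ≤ 1) :
    Real.sqrt y * (1 + Real.log (1 / y)) ^ N ≤ 2 ^ N * (1 + (2 * (N : ℝ)) ^ N) := by
  set L : ℝ := Real.log (1 / y) with hL
  have hLdef : L = -Real.log y := by rw [hL, one_div, Real.log_inv]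
  have hL0 : 0 ≤ L := by rw [hLdef]; have := Real.log_nonpos hy0.le hy1; linarith
  have hs0 : 0 ≤ Real.sqrt y := Real.sqrt_nonneg _
  have hs1 : Real.sqrt y ≤ 1 := Real.sqrt_le_one.2 hy1
  rcases Nat.eq_zero_or_pos N with rfl | hN
  · simp only [pow_zero, mul_one, Nat.cast_zero, mul_zero, one_mul]; linarith
  -- `√y L^N ≤ (2N)^N`: `|log y|·y^{1/(2N)} < 2N`
  have hN0 : (0 : ℝ) < N := by exact_mod_cast hN
  have ht : (0 : ℝ) < 1 / (2 * N) := by positivity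
  have hkey := Real.abs_log_mul_self_rpow_lt y (1 / (2 * N)) hy0 hy1 ht
  rw [one_div_one_div] at hkey
  have hlogabs : |Real.log y| = L := by rw [hLdef, abs_of_nonpos (Real.log_nonpos hy0.le hy1)]
  have h12 : 1 / (2 * (N : ℝ)) * (N : ℝ) = 1 / 2 := by field_simp
  have hprod : Real.sqrt y * L ^ N = (|Real.log y * y ^ (1 / (2 * (N : ℝ)))|) ^ N := by
    rw [abs_mul, abs_of_nonneg (Real.rpow_nonneg hy0.le _), mul_pow, hlogabs,
      ← Real.rpow_natCast (y ^ (1 / (2 * (N : ℝ)))) N, ← Real.rpow_mul hy0.le, h12, Real.sqrt_eq_rpow]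
    ring
  have hLN : Real.sqrt y * L ^ N ≤ (2 * (N : ℝ)) ^ N := by
    rw [hprod]
    exact pow_le_pow_left₀ (abs_nonneg _) hkey.le N
  -- `(1+L)^N ≤ 2^N max(1,L)^N ≤ 2^N (1 + L^N)`
  have h1L : (1 + L) ^ N ≤ 2 ^ N * (1 + L ^ N) := by
    have h1 : 1 + L ≤ 2 * max 1 L := by
      rcases le_total 1 L with h | h
      · rw [max_eq_right h]; linarith
      · rw [max_eq_left h]; linarith
    calc (1 + L) ^ N ≤ (2 * max 1 L) ^ N := pow_le_pow_left₀ (by linarith) h1 N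
      _ = 2 ^ N * (max 1 L) ^ N := mul_pow _ _ _
      _ ≤ 2 ^ N * (1 + L ^ N) := by
          gcongr
          rcases le_total 1 L with h | h
          · rw [max_eq_right h]; linarith
          · rw [max_eq_left h, one_pow]; linarith [pow_nonneg hL0 N]
  calc Real.sqrt y * (1 + L) ^ N ≤ Real.sqrt y * (2 ^ N * (1 + L ^ N)) := by gcongr
    _ = 2 ^ N * (Real.sqrt y + Real.sqrt y * L ^ N) := by ring
    _ ≤ 2 ^ N * (1 + (2 * (N : ℝ)) ^ N) := by gcongr

/-- **`|R_ab(y)| ≤ C√y` on `(0,1]`**, `R_ab(y) = ∫₀^y (ηI_ab(η) − m_ab(η)) dη/η`.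
[cite: KowalskiMichelVanderKam2000, (22)–(28) — derivation (remainder of the diagonal weight)] -/
theorem abs_shell_rem_le_sqrt (a b : ℕ) : ∃ C : ℝ, ∀ y : ℝ, 0 < y → y ≤ 1 →
    |∫ η in Ioc 0 y, (η * (∫ u in Ioi (0 : ℝ), Real.log u ^ a * Real.log (η / u) ^ b *
        (Real.exp (-(u + η / u)) / (1 - Real.exp (-(u + η / u))) ^ 2) / u) -
      ∫ v in Ioc (0 : ℝ) 1, ((-(Real.log (1 / η) / 2) + Real.log v) ^ a * (-(Real.log (1 / η) / 2) - Real.log v) ^ b +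
          (-(Real.log (1 / η) / 2) - Real.log v) ^ a * (-(Real.log (1 / η) / 2) + Real.log v) ^ b) *
        (v / (1 + v ^ 2) ^ 2)) / η| ≤ C * Real.sqrt y := by
  obtain ⟨C, hC⟩ := abs_integral_shell_rem_small_le a b
  have hC0 : 0 ≤ C := by
    have h := hC 1 one_pos le_rfl
    have : (0 : ℝ) ≤ C * 1 * (1 + Real.log (1 / 1)) ^ (a + b + 1) := (abs_nonneg _).trans h
    simpa using this
  refine ⟨C * (2 ^ (a + b + 1) * (1 + (2 * ((a + b + 1 : ℕ) : ℝ)) ^ (a + b + 1))), fun y hy0 hy1 ↦ ?_⟩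
  have h := hC y hy0 hy1
  have hs := sqrt_mul_one_add_log_pow_le (a + b + 1) hy0 hy1
  have hy : y = Real.sqrt y * Real.sqrt y := (Real.mul_self_sqrt hy0.le).symm
  calc _ ≤ C * y * (1 + Real.log (1 / y)) ^ (a + b + 1) := h
    _ = C * Real.sqrt y * (Real.sqrt y * (1 + Real.log (1 / y)) ^ (a + b + 1)) := by
        nth_rw 1 [hy]; ring
    _ ≤ C * Real.sqrt y * (2 ^ (a + b + 1) * (1 + (2 * ((a + b + 1 : ℕ) : ℝ)) ^ (a + b + 1))) := by gcongr
    _ = _ := by ring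

/-- **`|R_ab(y₁) − R_ab(y₂)| ≤ C(y₂−y₁)/√y₁` for `0 < y₁ ≤ y₂ ≤ 1`.**
[cite: KowalskiMichelVanderKam2000, (22)–(28) — derivation (remainder of the diagonal weight)] -/
theorem abs_shell_rem_sub_le_sqrt (a b : ℕ) : ∃ C : ℝ, ∀ y₁ y₂ : ℝ, 0 < y₁ → y₁ ≤ y₂ → y₂ ≤ 1 →
    |(∫ η in Ioc 0 y₁, (η * (∫ u in Ioi (0 : ℝ), Real.log u ^ a * Real.log (η / u) ^ b *
        (Real.exp (-(u + η / u)) / (1 - Real.exp (-(u + η / u))) ^ 2) / u) -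
      ∫ v in Ioc (0 : ℝ) 1, ((-(Real.log (1 / η) / 2) + Real.log v) ^ a * (-(Real.log (1 / η) / 2) - Real.log v) ^ b +
          (-(Real.log (1 / η) / 2) - Real.log v) ^ a * (-(Real.log (1 / η) / 2) + Real.log v) ^ b) *
        (v / (1 + v ^ 2) ^ 2)) / η) -
      ∫ η in Ioc 0 y₂, (η * (∫ u in Ioi (0 : ℝ), Real.log u ^ a * Real.log (η / u) ^ b *
        (Real.exp (-(u + η / u)) / (1 - Real.exp (-(u + η / u))) ^ 2) / u) -
      ∫ v in Ioc (0 : ℝ) 1, ((-(Real.log (1 / η) / 2) + Real.log v) ^ a * (-(Real.log (1 / η) / 2) - Real.log v) ^ b +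
          (-(Real.log (1 / η) / 2) - Real.log v) ^ a * (-(Real.log (1 / η) / 2) + Real.log v) ^ b) *
        (v / (1 + v ^ 2) ^ 2)) / η| ≤ C * (y₂ - y₁) / Real.sqrt y₁ := by
  obtain ⟨C₁, hC₁⟩ := abs_integral_shell_rem_le a b
  have hC₁0 : 0 ≤ C₁ := by
    have h := hC₁ (1 / 2) 1 (by norm_num) (by norm_num) le_rfl
    have h2 : (0 : ℝ) < (1 - 1 / 2) * (1 + Real.log (1 / (1 / 2))) ^ (a + b + 1) := by
      have : 0 ≤ Real.log (1 / (1 / 2)) := Real.log_nonneg (by norm_num)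
      positivity
    have h3 : 0 ≤ C₁ * ((1 - 1 / 2) * (1 + Real.log (1 / (1 / 2))) ^ (a + b + 1)) := by
      rw [← mul_assoc]; exact (abs_nonneg _).trans h
    exact nonneg_of_mul_nonneg_left h3 h2
  set c : ℝ := 2 ^ (a + b + 1) * (1 + (2 * ((a + b + 1 : ℕ) : ℝ)) ^ (a + b + 1)) with hc
  refine ⟨C₁ * c, fun y₁ y₂ hy₁ h12 hy₂ ↦ ?_⟩
  have hrem := integrableOn_shell_rem a b
  set f : ℝ → ℝ := fun η ↦ (η * (∫ u in Ioi (0 : ℝ), Real.log u ^ a * Real.log (η / u) ^ b *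
        (Real.exp (-(u + η / u)) / (1 - Real.exp (-(u + η / u))) ^ 2) / u) -
      ∫ v in Ioc (0 : ℝ) 1, ((-(Real.log (1 / η) / 2) + Real.log v) ^ a * (-(Real.log (1 / η) / 2) - Real.log v) ^ b +
          (-(Real.log (1 / η) / 2) - Real.log v) ^ a * (-(Real.log (1 / η) / 2) + Real.log v) ^ b) *
        (v / (1 + v ^ 2) ^ 2)) / η with hf
  have hsplit : ∫ η in Ioc 0 y₂, f η = (∫ η in Ioc 0 y₁, f η) + ∫ η in Ioc y₁ y₂, f η := by
    rw [← Ioc_union_Ioc_eq_Ioc hy₁.le h12, setIntegral_union ?_ measurableSet_Ioc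
      (hrem.mono_set (Ioc_subset_Ioc_right (h12.trans hy₂)))
      (hrem.mono_set fun η hη ↦ ⟨hy₁.trans hη.1, hη.2.trans hy₂⟩)]
    rw [Set.disjoint_left]; intro η h1 h2; exact absurd h2.1 (not_lt.2 h1.2)
  have hdiff : (∫ η in Ioc 0 y₁, f η) - ∫ η in Ioc 0 y₂, f η = -∫ η in Ioc y₁ y₂, f η := by rw [hsplit]; ring
  have hmain := hC₁ y₁ y₂ hy₁ h12 hy₂
  have hs := sqrt_mul_one_add_log_pow_le (a + b + 1) hy₁ (h12.trans hy₂)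
  have hs0 : 0 < Real.sqrt y₁ := Real.sqrt_pos.2 hy₁
  show |(∫ η in Ioc 0 y₁, f η) - ∫ η in Ioc 0 y₂, f η| ≤ C₁ * c * (y₂ - y₁) / Real.sqrt y₁
  rw [hdiff, abs_neg, le_div_iff₀ hs0]
  calc |∫ η in Ioc y₁ y₂, f η| * Real.sqrt y₁ ≤ C₁ * (y₂ - y₁) * (1 + Real.log (1 / y₁)) ^ (a + b + 1) * Real.sqrt y₁ :=
        mul_le_mul_of_nonneg_right hmain hs0.le
    _ = C₁ * (y₂ - y₁) * (Real.sqrt y₁ * (1 + Real.log (1 / y₁)) ^ (a + b + 1)) := by ring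
    _ ≤ C₁ * (y₂ - y₁) * c := by
        apply mul_le_mul_of_nonneg_left hs
        exact mul_nonneg hC₁0 (by linarith)
    _ = C₁ * c * (y₂ - y₁) := by ring

end Summit.Parity.GeneralizedHardyLittlewood.Theorems.MomentsBeyondDiagonal.DiagLines

end
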